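import Mathlib.FieldTheory.IsSepClosed
import Mathlib.FieldTheory.Normal.Closure
import Mathlib.FieldTheory.Galois.Basic
import HarnessLib

/-!
# A finite Galois extension into which finitely many finite separable extensions embed

Topic: `Literature/AlgebraicGeometry/Resolution`. The field-theoretic step of de Jong 1996, 4.16:

> "Let `Z = ⋃ᵢ₌₁ⁿ Zᵢ` be the decomposition into irreducible components of `Z`. Choose a finite
> separable Galois extension `k(Y) ⊂ L` such that `k(Zᵢ)` may be embedded over `k(Y)` into `L`
> for all `i`; this is possible as the field extensions `k(Y) ⊂ k(Zᵢ)` are finite separable by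
> (vi) d)." (p. 71)

Everything here is PROVED, for an arbitrary field `K` and a finite family of finite separable
extensions `Eᵢ / K`:

* `exists_isGalois_splits_minpoly` — there is a finite Galois extension `L / K` into which every
  `Eᵢ` embeds over `K` and in which, moreover, the minimal polynomial over `K` of every element
  of every `Eᵢ` splits (`L` = the compositum, inside a separable closure of `K`, of the normal
  closures of the `Eᵢ`). The splitting is the form in which 4.16 uses `L`: it makes every
  compositum of `Eᵢ` and `L` over `K` collapse to `L` ("`Z'ᵢ → Y'` finite and birational");
* `apply_mem_range_of_splits_minpoly`, `range_subset_range_of_splits_minpoly` — the collapse, in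
  the form: if `K → E` is algebraic, `j : K → F`, and `a : E → Ω`, `r : F → Ω` are ring maps into
  a field agreeing on `K`, and the minimal polynomial of every element of `E` splits in `F`, then
  `a(E) ⊆ r(F)`.

## Sources

* A. J. de Jong, *Smoothness, semi-stability and alterations*, Publ. Math. IHÉS 83 (1996) 51–93:
  4.16 (p. 71).
-/

namespace Literature.AlgebraicGeometry.Resolution

universe u v

open Polynomial IntermediateField

/-- **A finite Galois extension splitting finitely many finite separable extensions** (de Jong
1996, 4.16: "Choose a finite separable Galois extension `k(Y) ⊂ L` such that `k(Zᵢ)` may be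
embedded over `k(Y)` into `L` for all `i`; this is possible as the field extensions
`k(Y) ⊂ k(Zᵢ)` are finite separable"). For a field `K` and finitely many finite separable
extensions `Eᵢ` of `K` there is a finite Galois extension `L` of `K` such that every `Eᵢ`
embeds into `L` over `K` and the minimal polynomial over `K` of every element of every `Eᵢ`
splits in `L`. Construction: the compositum of the normal closures of the `Eᵢ` inside a
separable closure of `K`. [cite: DeJong1996, 4.16, p. 71] -/
theorem exists_isGalois_splits_minpoly (K : Type u) [Field K] {ι : Type v} [Finite ι]
    (E : ι → Type u) [∀ i, Field (E i)] [∀ i, Algebra K (E i)]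
    [∀ i, FiniteDimensional K (E i)] [∀ i, Algebra.IsSeparable K (E i)] :
    ∃ (L : Type u) (_ : Field L) (_ : Algebra K L), FiniteDimensional K L ∧ IsGalois K L ∧
      (∀ i, Nonempty (E i →ₐ[K] L)) ∧
        ∀ (i) (t : E i), ((minpoly K t).map (algebraMap K L)).Splits := by
  let Ω : Type u := SeparableClosure K
  let N : ι → IntermediateField K Ω := fun i => normalClosure K (E i) Ω
  let L : IntermediateField K Ω := ⨆ i, N i
  haveI : FiniteDimensional K L := IntermediateField.finiteDimensional_iSup_of_finite
  haveI hN : ∀ i, Normal K (N i) := fun i => normalClosure.normal K (E i) Ω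
  haveI : Normal K L := IntermediateField.normal_iSup K Ω N
  haveI : Algebra.IsSeparable K L := Algebra.isSeparable_tower_bot_of_isSeparable K L Ω
  haveI : IsGalois K L := IsGalois.mk
  -- an embedding of `E i` into its normal closure
  have φ : ∀ i, E i →ₐ[K] N i := fun i =>
    (normalClosure.algHomEquiv K (E i) Ω).symm (IsSepClosed.lift (K := K) (L := E i) (M := Ω))
  refine ⟨L, inferInstance, inferInstance, inferInstance, inferInstance, fun i => ?_, fun i t => ?_⟩
  · exact ⟨(IntermediateField.inclusion (le_iSup N i)).comp (φ i)⟩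
  · have hinj : Function.Injective (φ i) := (φ i).toRingHom.injective
    have h1 : ((minpoly K (φ i t)).map (algebraMap K (N i))).Splits := (hN i).splits (φ i t)
    rw [minpoly.algHom_eq (φ i) hinj t] at h1
    exact h1.of_algHom (IntermediateField.inclusion (le_iSup N i))

/-- **Roots of a split polynomial stay in the splitting field**: let `K → E` be an algebraic field
extension, `j : K → F` a field map, and `a : E → Ω`, `r : F → Ω` ring maps into a field which
agree on `K`. If the minimal polynomial over `K` of `t ∈ E` splits in `F`, then `a t` lies in the
image of `r` — it is a root of that polynomial mapped to `Ω` through `r`. [folklore] -/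
theorem apply_mem_range_of_splits_minpoly {K E F Ω : Type*} [Field K] [Field E] [Field F]
    [Field Ω] [Algebra K E] (j : K →+* F) (a : E →+* Ω) (r : F →+* Ω)
    (hcomm : a.comp (algebraMap K E) = r.comp j) {t : E} (hint : IsIntegral K t)
    (hsplit : ((minpoly K t).map j).Splits) : a t ∈ r.range := by
  refine hsplit.mem_range_of_isRoot ?_ ?_
  · exact (Polynomial.map_ne_zero_iff j.injective).mpr (minpoly.ne_zero hint)
  · rw [Polynomial.IsRoot.def, Polynomial.eval_map, Polynomial.eval₂_map, ← hcomm,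
      ← Polynomial.hom_eval₂, ← Polynomial.aeval_def, minpoly.aeval, map_zero]

/-- **The image of an algebraic extension all of whose minimal polynomials split in `F` lies in
the image of `F`**: with `K → E` algebraic, `j : K → F`, and `a : E → Ω`, `r : F → Ω` agreeing
on `K`, if the minimal polynomial over `K` of every element of `E` splits in `F` then
`a(E) ⊆ r(F)` (de Jong 1996, 4.16: over the Galois extension `L ⊇ k(Zᵢ)` the components of
`Zᵢ ×_Y Y'` are birational to `Y'`). [cite: DeJong1996, 4.16, p. 71] -/
theorem range_subset_range_of_splits_minpoly {K E F Ω : Type*} [Field K] [Field E] [Field F]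
    [Field Ω] [Algebra K E] [Algebra.IsAlgebraic K E] (j : K →+* F) (a : E →+* Ω) (r : F →+* Ω)
    (hcomm : a.comp (algebraMap K E) = r.comp j)
    (hsplit : ∀ t : E, ((minpoly K t).map j).Splits) : Set.range a ⊆ Set.range r := by
  rintro _ ⟨t, rfl⟩
  exact apply_mem_range_of_splits_minpoly j a r hcomm (Algebra.IsIntegral.isIntegral t) (hsplit t)

end Literature.AlgebraicGeometry.Resolution
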